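import Summits.ValiantsHypothesis.ValiantsHypothesis.Theorems.KPlusLogSqLawSymmetricTwoKDesign

/-!
# Route «KPlusLogSqLaw» — the symmetric `(2, K)` tropical family with `3K − 4` alternations, part 3/3: the CHAIN and the census floors
# `T_sym(2,K) ≥ 3K − 4`, `ζ₊(2,K) ≥ 3K − 4` for every `K ≥ 3` (toward crux `Lifting`, stmt-ValiantsHypothesis-19772; GAP-LIFT.md §8)

HONEST FRAMING as in parts 1–2.  RESULTS (all proved): `chainT`/`thC` (the `3K − 3` vertices `P_{0,0}, P_{0,1}, c_1, P_{0,2}, c_2, …,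
c_{K−2}, P_{0,K−1}, P_{1,K−1}, …, P_{K−1,K−1}` at strictly increasing integer slopes), `isDominant_chainT`, `termSign_chainT` (sign
`(−1)^{k+1}`: the c-points sit at the even positions), `alternates_chainT`; **`le_of_tropRootLawAt_two : 3 ≤ K → TropRootLawAt 2 K B →
3K − 4 ≤ B`** (the symmetric tropical census at `m = 2` reaches the patchwork ceiling `3K − 4` of HOME/lead/PATCHWORK-CEILING.md, for every
`K`); **`le_of_posRootLawAt_two : 3 ≤ K → PosRootLawAt 2 K B → 3K − 4 ≤ B`** by symmetric patchworking (`symmDesign_le_of_posRootLawAt`);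
**`not_posRootLawAt_two : 3 ≤ K → ¬ PosRootLawAt 2 K (3K − 5)`**, `not_realRootLawAt_two` — `ζ₊(2,K) ≥ 3K − 4` for every `K ≥ 3` in ONE
theorem (per-`K` census rows of record are stronger where they exist: `(2,4) = 9`, `(2,5) = 14`, …; nothing here bears on DoorA26). [folklore]
-/

-- `Summit.ValiantsHypothesis.ValiantsHypothesis.…` repeats a component by the D-0017 layout
-- (single-conjunct summit), which the `dupNamespace` linter flags; the name is mandated.
set_option linter.dupNamespace false
set_option autoImplicit false

namespace Summit.ValiantsHypothesis.ValiantsHypothesis.Theorems.LacunarySymmetroidMatrixDescartes.TropicalCensus.SymTwoK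

open Summit.ValiantsHypothesis.ValiantsHypothesis.Theorems.MatrixDescartes.Negative
open Summit.ValiantsHypothesis.ValiantsHypothesis.Theorems.LacunarySymmetroidMatrixDescartes
open scoped BigOperators
open Finset

variable (K : ℕ)

/-! ### The chain of `3K − 3` dominant terms -/

/-- the `k`-th chain term (`k = 0 … 3K−4`): `P_{0,0}`; then alternately `P_{0,j}` (odd `k = 2j−1`) and `c_j` (even `k = 2j`) up to
`P_{0,K−1}` (`k = 2K−3`); then the second leg `P_{i,K−1}` (`k = 2K−3+i`). -/
def chainT (hK : 3 ≤ K) (k : ℕ) : Equiv.Perm (Fin 2) × (Fin 2 → Fin K) :=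
  if h1 : k ≤ 2 * K - 3 then
    (if k % 2 = 0 ∧ 2 ≤ k then swT K ⟨k / 2, by omega⟩ ⟨k / 2, by omega⟩
     else idT K ⟨0, by omega⟩ ⟨(k + 1) / 2, by omega⟩)
  else idT K ⟨min (k - (2 * K - 3)) (K - 1), by omega⟩ ⟨K - 1, by omega⟩

/-- the sample slopes of the chain. -/
def thC (k : ℕ) : ℤ :=
  if k ≤ 2 * K - 3 then
    (if k % 2 = 0 ∧ 2 ≤ k then 2 * V * (((k / 2 : ℕ) : ℤ) + 1) else 2 * V * (((k + 1) / 2 : ℕ) : ℤ) + 4)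
  else 2 * V * ((K : ℤ) + ((k - (2 * K - 3) : ℕ) : ℤ)) + 4

/-- `thC_lt_succ` (see the module docstring). [folklore] -/
theorem thC_lt_succ (hK : 3 ≤ K) (k : ℕ) : thC K k < thC K (k + 1) := by
  have hV : V = 8 := rfl
  unfold thC
  rw [hV]
  have h2 := Nat.div_add_mod k 2
  have h3 := Nat.div_add_mod (k + 1) 2
  have h4 := Nat.mod_lt k (show 0 < 2 by norm_num)
  split_ifs <;> push_cast <;> omega

/-- `isDominant_chainT` (see the module docstring). [folklore] -/
theorem isDominant_chainT (hK : 3 ≤ K) (k : ℕ) (hk : k ≤ 3 * K - 4) :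
    IsDominant (dd K) (vv K) (ee K) (thC K k) (chainT K hK k) := by
  unfold chainT thC
  by_cases h1 : k ≤ 2 * K - 3
  · rw [dif_pos h1, if_pos h1]
    by_cases h2 : k % 2 = 0 ∧ 2 ≤ k
    · rw [if_pos h2, if_pos h2]
      exact domB K (k / 2) (by omega) (by omega)
    · rw [if_neg h2, if_neg h2]
      exact domA K ((k + 1) / 2) (by omega)
  · rw [dif_neg h1, if_neg h1]
    have hmin : min (k - (2 * K - 3)) (K - 1) = k - (2 * K - 3) := Nat.min_eq_left (by omega)
    have := domC K (k - (2 * K - 3)) (by omega) (by omega)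
    simp only [hmin]
    exact this

/-- `termSign_chainT` (see the module docstring). [folklore] -/
theorem termSign_chainT (hK : 3 ≤ K) (k : ℕ) (hk : k ≤ 3 * K - 4) :
    termSign (ee K) (chainT K hK k) = (-1) ^ (k + 1) := by
  unfold chainT
  by_cases h1 : k ≤ 2 * K - 3
  · rw [dif_pos h1]
    by_cases h2 : k % 2 = 0 ∧ 2 ≤ k
    · rw [if_pos h2, termSign_swT]
      obtain ⟨r, hr⟩ : ∃ r, k + 1 = 2 * r + 1 := ⟨k / 2, by omega⟩
      rw [hr, pow_succ, pow_mul]; norm_num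
    · rw [if_neg h2, termSign_idT]
      simp only [pow_zero, one_mul]
      rcases Nat.eq_zero_or_pos k with h0 | h0
      · subst h0; simp
      · have hodd : k % 2 = 1 := by omega
        have hne : (k + 1) / 2 ≠ 0 := by omega
        rw [if_neg hne]
        obtain ⟨r, hr⟩ : ∃ r, k + 1 = 2 * r := ⟨(k + 1) / 2, by omega⟩
        rw [hr, pow_mul]; norm_num
  · rw [dif_neg h1, termSign_idT]
    have hmin : min (k - (2 * K - 3)) (K - 1) = k - (2 * K - 3) := Nat.min_eq_left (by omega)
    simp only [hmin]
    rw [if_neg (by omega : K - 1 ≠ 0), mul_one]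
    obtain ⟨r, hr⟩ : ∃ r, k + 1 = (k - (2 * K - 3)) + 2 * r := ⟨K - 1, by omega⟩
    rw [hr, pow_add, pow_mul]; norm_num

/-- `alternates_chainT` (see the module docstring). [folklore] -/
theorem alternates_chainT (hK : 3 ≤ K) (k : ℕ) (hk : k + 1 ≤ 3 * K - 4) :
    termSign (ee K) (chainT K hK k) * termSign (ee K) (chainT K hK (k + 1)) < 0 := by
  rw [termSign_chainT K hK k (by omega), termSign_chainT K hK (k + 1) hk, ← pow_add,
    show k + 1 + (k + 1 + 1) = 2 * (k + 1) + 1 by ring, pow_succ, pow_mul]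
  norm_num

/-! ### The census floors at `m = 2` -/

/-- **The symmetric tropical census at `m = 2` reaches the patchwork ceiling**: every bound `B` of the tropical row `(2, K)`,
`K ≥ 3`, satisfies `3K − 4 ≤ B` — realised by a SYMMETRIC design (so `T_sym(2,K) ≥ 3K − 4`; with the cell's ceiling
`T_sym(2,K) ≤ 3K − 4`, PATCHWORK-CEILING.md, this is sharp). [folklore] -/
theorem le_of_tropRootLawAt_two (hK : 3 ≤ K) {B : ℕ} (h : TropRootLawAt 2 K B) : 3 * K - 4 ≤ B :=
  h (dd K) (vv K) (ee K) (3 * K - 4) (fun k => thC K k) (fun k => chainT K hK k) (ee_natAbs K)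
    (Fin.strictMono_iff_lt_succ.mpr fun k => by
      simpa only [Fin.val_castSucc, Fin.val_succ] using thC_lt_succ K hK k)
    (fun k => isDominant_chainT K hK k (by have := k.isLt; omega))
    (fun k => by
      simpa only [Fin.val_castSucc, Fin.val_succ] using alternates_chainT K hK k (by have := k.isLt; omega))

/-- **The real symmetric census at `m = 2` is at least `3K − 4` for every `K ≥ 3`**: `PosRootLawAt 2 K B → 3K − 4 ≤ B`, by symmetric
patchworking (`symmDesign_le_of_posRootLawAt`) of the design. [folklore] -/
theorem le_of_posRootLawAt_two (hK : 3 ≤ K) {B : ℕ} (h : PosRootLawAt 2 K B) : 3 * K - 4 ≤ B :=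
  symmDesign_le_of_posRootLawAt h (dd K) (vv K) (ee K) (vv_symm K) (ee_symm K) (ee_natAbs K)
    (fun k => thC K k)
    (Fin.strictMono_iff_lt_succ.mpr fun k => by
      simpa only [Fin.val_castSucc, Fin.val_succ] using thC_lt_succ K hK k)
    (fun k => chainT K hK k)
    (fun k => isDominant_chainT K hK k (by have := k.isLt; omega))
    (fun k => by
      simpa only [Fin.val_castSucc, Fin.val_succ] using alternates_chainT K hK k (by have := k.isLt; omega))

/-- **`ζ₊(2,K) ≥ 3K − 4` for every `K ≥ 3`**: the row `PosRootLawAt 2 K (3K − 5)` is false. [folklore] -/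
theorem not_posRootLawAt_two (hK : 3 ≤ K) : ¬ PosRootLawAt 2 K (3 * K - 5) := fun h => by
  have := le_of_posRootLawAt_two K hK h
  omega

/-- and so is the all-real-zeros row `RealRootLawAt 2 K (3K − 5)`. [folklore] -/
theorem not_realRootLawAt_two (hK : 3 ≤ K) : ¬ RealRootLawAt 2 K (3 * K - 5) :=
  fun h => not_posRootLawAt_two K hK (Census.posRootLawAt_of_realRootLawAt h)

end Summit.ValiantsHypothesis.ValiantsHypothesis.Theorems.LacunarySymmetroidMatrixDescartes.TropicalCensus.SymTwoK
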